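import Summits.QuantumFields.BalabanUV.Beta.FP.CombSliceJetLetters
import Summits.QuantumFields.BalabanUV.Beta.FP.CompositeWardLetters
import Summits.QuantumFields.BalabanUV.Beta.FP.ForestTriangularJets

/-!
# `BalabanUV.Beta.FP.NestedStepLawOneShotLetters` — road «FP» for binder row D1, ROUTE T (R-FP-51∕52), branch (β) (jets only):
# **THE ONE-SHOT-SLICED COMPOSITE STEP LAW IN LETTER FORM** — `NestedStepLawOneShotJets.secondVar_oneShot_nestedStepLaw_jets_of_uni` (p308750 ✓) with its
# structural hypotheses replaced by the rows of the (T-ID) letter checklist (`HOME/b2b-balaban-beta-d1-p3/TID-LETTER-SPEC.md` § B): the composite `𝔔`-letters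
# `b0 b1 b2` ← leaf-02's `CompositeWardLetters.compWard_b*` from the ONE-STEP covariance letters and the COARSE Ward letters; the Faddeev–Popov binders
# `hPW hTW` ← unimodularity letters `|det| = c ≠ 0` (GENERAL constants — the coarse generator of record carries the displayed factor `stepScale·#B`,
# `TorusGaugeCovarianceCoarse`); `hUP hUT` ← EITHER the STATIC generator frame (§2: `W₁ = W₂ = 0`, the insertion tables kill the static generators) OR the
# FOREST frame (§3: the Faddeev–Popov 2-jets are triangular along one ranked forest with colour-stripped scalar site blocks `d₀d₂ = d₁²`,
# `ForestTriangularJets` p309752 ✓); §4 the generic half of the «big-comb basis change» (`secondVar` and `det ≠ 0` are invariant under a static invertible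
# right factor of the generators); §5 (v1.3 APPEND) the HAAR frame — exit (E3) of the owner's located question Q-FP-17-2′: the one-shot slice reads only dead
# bonds (`P·W₁ = P·W₂ = 0`), the nested Faddeev–Popov 2-jet is forest-triangular, and its defect is DISPLAYED as `−2·Σ_x secondVar(site block)`.
# OUTPUT (§2, §3) = p308750's conclusion verbatim; §5 = the same plus the displayed per-site sum.  PURPOSE: the torus instance (`NestedStepLawTorusInstance`, (T-INST-j)) becomes ONE
# `exact` per checklist row; no torus name occurs in this file.

HONEST DEPENDENCY (page 1, mandatory): continuum YM on T⁴ ⇐ BetaPertH ∧ nine spine estimates (0/9 proved); BetaPertH ⇐ (D1) ∧ (D4) ∧ CAP+tail;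
G-an2-4 gates asym, D1 and NE2/3/4.  HONEST FRAMING (cell contract, verbatim): «discharging `BetaPertH` makes Bałaban's UV stability UNCONDITIONAL —
a real constructive-QFT result; it is NOT the continuum limit and NOT the Clay problem.»  ABSOLUTE RULE (cell charter, verbatim): «No internally-minted
statement may enter as a cited fact. Every hypothesis is either kernel-proved in this package or a verbatim quotation of a PUBLISHED theorem with page
reference. The manuscript(s) under audit are NOT citable for their own disputed steps — they are the thing under adjudication; programme-internal
(2001/route/tribunal) claims are never citable.»  THIS MODULE is [folklore] finite-matrix algebra over files already in the tree; no `def`, no `def … : Prop`,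
nothing cited, 0 sorry.  It discharges 0∕4 row-D1 binders: the LETTERS themselves (the torus TABLE IDENTITIES of the literal — one-step covariance jets
`c*`, coarse Ward jets `d*`, composite Ward letters `a*`, (UNI) `|det| = c`, (INV) `det ≠ 0`, and in §3 the triangularity ∕ site letters) are HYPOTHESES here —
NOT (T-ID), NOT SDF, NOT D1, NOT BetaPertH, NOT continuum, NOT Clay.  «not in print; our bookkeeping».

WHICH FRAME (owner question Q-FP-17-2 → an2, open at filing): if the literal's chart (III′) keeps the residual gauge generators STATIC along the background
(`W₁ = W₂ = 0`), §2 is the call and the (UNI) jet letters are AUTOMATIC; if the generators MOVE (BF-x `C ⊗ djF`-type jets), §3 is the call and the dictionary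
certifies triangularity along the comb forest (leaf-06 `CombSliceJetLetters.combRowsT_mul_forestTriangular`) plus the per-site scalar letter.  Both land now
so that an2's answer selects a theorem, not a rewrite.
Provenance: road «FP» OWNER, unit b2b-balaban-beta-d1-p3 gen 17, 2026-08-21∕22 (INTENT I-FP-17-6).  No existing file touched.
-/

namespace Summit.QuantumFields.BalabanUV.Beta.FP.NestedStepLawOneShotLetters

open Matrix Finset
open Literature.MathematicalPhysics.QuantumFieldTheory.Balaban1983to89.Beta.Composition (kkt)
open Literature.MathematicalPhysics.QuantumFieldTheory.Balaban1983to89.Beta.CompositionSingular (effForm flucCov minOp minOpL)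
open Summit.QuantumFields.BalabanUV.Beta.D1BFx.LogDetSecondVariation (secondVar)
open Summit.QuantumFields.BalabanUV.Beta.FP.NestedStepLawOneShot (abs_det_nestedSlice_mul_gauge)
open Summit.QuantumFields.BalabanUV.Beta.FP.NestedStepLawOneShotJets (secondVar_oneShot_nestedStepLaw_jets secondVar_oneShot_nestedStepLaw_jets_of_uni)
open Summit.QuantumFields.BalabanUV.Beta.FP.CompositeWardLetters (compWard_b0 compWard_b1 compWard_b2)
open Summit.QuantumFields.BalabanUV.Beta.FP.CombSliceJetLetters (secondVar_zero_jets fromRows_mul_eq_zero_of_jet)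
open Summit.QuantumFields.BalabanUV.Beta.FP.CombSliceUnimodular (det_of_forestTriangular)
open Summit.QuantumFields.BalabanUV.Beta.FP.ForestTriangularJets (secondVar_forestTriangular_jets secondVar_forestTriangular_jets_eq_zero)

/-! ## §1 Letter-to-binder helpers (the static-frame one-liners `secondVar_zero_jets`, `fromRows_mul_eq_zero_of_jet` are leaf-06's, `CombSliceJetLetters` p310409 ✓) -/

section Helpers

variable {ι ν μ ρ₁ ρ₂ : Type*} [Fintype ι] [Fintype ν] [Fintype μ] [Fintype ρ₁] [Fintype ρ₂] [DecidableEq ι] [DecidableEq ρ₁] [DecidableEq ρ₂]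

omit [Fintype ν] [Fintype μ] [Fintype ρ₁] [Fintype ρ₂] [DecidableEq ρ₁] [DecidableEq ρ₂] in
/-- [folklore] an absolute-value letter `|det A| = c` with `c ≠ 0` is the binder `det A ≠ 0`. -/
theorem det_ne_zero_of_abs_det {A : Matrix ι ι ℝ} {c : ℝ} (h : |A.det| = c) (hc : c ≠ 0) : A.det ≠ 0 := by
  rintro h0; rw [h0, abs_zero] at h; exact hc h.symm

omit [DecidableEq ι] [Fintype ι] in
/-- [folklore] **`hTW` FROM THE UNIMODULARITY LETTERS WITH GENERAL CONSTANTS** (LEMMA N `abs_det_nestedSlice_mul_gauge`, p307295): `Q₁₀D₁ = 0`, `Q₁₀D₂ = D̄`,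
`|det(τ₁D₁)| = c₁ ≠ 0`, `|det(τ₂D̄)| = c₂ ≠ 0` ⇒ `det([τ₂Q₁₀; τ₁]·[D₂|D₁]) ≠ 0`.  (At the torus instance `c₁ = 1` and `c₂ = (stepScale·#B)^{|ρ₂|}`.) -/
theorem det_nestedSlice_mul_gauge_ne_zero (τ₁ : Matrix ρ₁ ν ℝ) (τ₂ : Matrix ρ₂ μ ℝ) (Q₁₀ : Matrix μ ν ℝ) (D₁ : Matrix ν ρ₁ ℝ) (D₂ : Matrix ν ρ₂ ℝ)
    (Dbar : Matrix μ ρ₂ ℝ) {c₁ c₂ : ℝ} (h₁ : Q₁₀ * D₁ = 0) (h₂ : Q₁₀ * D₂ = Dbar) (hc₁ : |(τ₁ * D₁).det| = c₁) (hc₂ : |(τ₂ * Dbar).det| = c₂)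
    (hc₁0 : c₁ ≠ 0) (hc₂0 : c₂ ≠ 0) :
    (fromRows (τ₂ * Q₁₀) τ₁ * fromCols D₂ D₁).det ≠ 0 :=
  det_ne_zero_of_abs_det (abs_det_nestedSlice_mul_gauge τ₁ τ₂ Q₁₀ D₁ D₂ Dbar h₁ h₂ hc₁ hc₂) (mul_ne_zero hc₂0 hc₁0)

end Helpers

/-! ## §2 THE CALL in letter form — STATIC generator frame -/

section Static

variable {ν μ κ ρ₁ ρ₂ : Type*} [Fintype ν] [Fintype μ] [Fintype κ] [Fintype ρ₁] [Fintype ρ₂]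
  [DecidableEq ν] [DecidableEq μ] [DecidableEq κ] [DecidableEq ρ₁] [DecidableEq ρ₂]

/-- [folklore] **THE ONE-SHOT-SLICED COMPOSITE STEP LAW FROM THE LETTER CHECKLIST, STATIC GENERATOR FRAME.**  Data as in p308750 with the fine generators
`W₀ = [D₂|D₁]` (coarse-descending ⊕ residual) and the coarse generator `D̄` STATIC.  Letters: composite Ward `a0 a1 a2` (+ transposes; static shapes),
one-step covariance `h₁ : Q₁₀D₁ = 0`, `h₂ : Q₁₀D₂ = D̄` (order 0 — `TorusGaugeCovariance(Coarse)` MASTER) and `c1 : Q₁₁·[D₂|D₁] = 0`, `c2 : Q₁₂·[D₂|D₁] = 0`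
(orders 1, 2 — the insertion tables kill the static generators), coarse Ward `d0 d1 d2 : Q₂ₖ·D̄ = 0`, (UNI) `|det(P·[D₂|D₁])| = c'`, `|det(τ₁D₁)| = c₁`,
`|det(τ₂D̄)| = c₂` with non-zero constants, (INV) `h1 h2`.  Conclusion: p308750's, with ZERO Faddeev–Popov defect. -/
theorem secondVar_oneShot_nestedStepLaw_of_letters_static
    (H₀ H₁ H₂ : Matrix ν ν ℝ) (Q₁₀ Q₁₁ Q₁₂ : Matrix μ ν ℝ) (Q₂₀ Q₂₁ Q₂₂ : Matrix κ μ ℝ) (G₀ G₁ G₂ : Matrix μ μ ℝ)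
    (τ₁ : Matrix ρ₁ ν ℝ) (τ₂ : Matrix ρ₂ μ ℝ) (P : Matrix (ρ₂ ⊕ ρ₁) ν ℝ) (D₁ : Matrix ν ρ₁ ℝ) (D₂ : Matrix ν ρ₂ ℝ) (Dbar : Matrix μ ρ₂ ℝ)
    (Y₀ Y₁ Y₂ Y'₀ Y'₁ Y'₂ : Matrix κ (ρ₂ ⊕ ρ₁) ℝ)
    {𝔎₀ 𝔎₁ 𝔎₂ : Matrix ν ν ℝ} {𝔔₀ 𝔔₁ 𝔔₂ : Matrix κ ν ℝ}
    (h𝔎₀ : H₀ + Q₁₀ᵀ * G₀ * Q₁₀ = 𝔎₀) (h𝔎₁ : H₁ + (Q₁₁ᵀ * G₀ * Q₁₀ + Q₁₀ᵀ * G₁ * Q₁₀ + Q₁₀ᵀ * G₀ * Q₁₁) = 𝔎₁)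
    (h𝔎₂ : H₂ + ((Q₁₂ᵀ * G₀ * Q₁₀ + Q₁₁ᵀ * G₁ * Q₁₀ + Q₁₁ᵀ * G₀ * Q₁₁) + (Q₁₁ᵀ * G₁ * Q₁₀ + Q₁₀ᵀ * G₂ * Q₁₀ + Q₁₀ᵀ * G₁ * Q₁₁)
            + (Q₁₁ᵀ * G₀ * Q₁₁ + Q₁₀ᵀ * G₁ * Q₁₁ + Q₁₀ᵀ * G₀ * Q₁₂)) = 𝔎₂)
    (h𝔔₀ : Q₂₀ * Q₁₀ = 𝔔₀) (h𝔔₁ : Q₂₁ * Q₁₀ + Q₂₀ * Q₁₁ = 𝔔₁) (h𝔔₂ : Q₂₂ * Q₁₀ + Q₂₁ * Q₁₁ + (Q₂₁ * Q₁₁ + Q₂₀ * Q₁₂) = 𝔔₂)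
    -- composite Ward letters, static shapes
    (a0 : 𝔎₀ * fromCols D₂ D₁ = 𝔔₀ᵀ * Y₀) (a1 : 𝔎₁ * fromCols D₂ D₁ = 𝔔₁ᵀ * Y₀ + 𝔔₀ᵀ * Y₁)
    (a2 : 𝔎₂ * fromCols D₂ D₁ = 𝔔₂ᵀ * Y₀ + (2 : ℝ) • (𝔔₁ᵀ * Y₁) + 𝔔₀ᵀ * Y₂)
    (a0t : 𝔎₀ᵀ * fromCols D₂ D₁ = 𝔔₀ᵀ * Y'₀) (a1t : 𝔎₁ᵀ * fromCols D₂ D₁ = 𝔔₁ᵀ * Y'₀ + 𝔔₀ᵀ * Y'₁)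
    (a2t : 𝔎₂ᵀ * fromCols D₂ D₁ = 𝔔₂ᵀ * Y'₀ + (2 : ℝ) • (𝔔₁ᵀ * Y'₁) + 𝔔₀ᵀ * Y'₂)
    -- one-step covariance letters (order 0) and insertion letters (orders 1, 2), coarse Ward letters
    (h₁ : Q₁₀ * D₁ = 0) (h₂ : Q₁₀ * D₂ = Dbar) (c1 : Q₁₁ * fromCols D₂ D₁ = 0) (c2 : Q₁₂ * fromCols D₂ D₁ = 0)
    (d0 : Q₂₀ * Dbar = 0) (d1 : Q₂₁ * Dbar = 0) (d2 : Q₂₂ * Dbar = 0)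
    -- (UNI) letters with general constants
    {c' c₁ c₂ : ℝ} (hcP : |(P * fromCols D₂ D₁).det| = c') (hc₁ : |(τ₁ * D₁).det| = c₁) (hc₂ : |(τ₂ * Dbar).det| = c₂)
    (hc'0 : c' ≠ 0) (hc₁0 : c₁ ≠ 0) (hc₂0 : c₂ ≠ 0)
    {Γ : Matrix ν ν ℝ} {I : Matrix ν (μ ⊕ ρ₁) ℝ} {L : Matrix (μ ⊕ ρ₁) ν ℝ} {S : Matrix (μ ⊕ ρ₁) (μ ⊕ ρ₁) ℝ} {B : Matrix (μ ⊕ ρ₁) ν ℝ}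
    (hΓ : flucCov H₀ (fromRows Q₁₀ τ₁) = Γ) (hI : minOp H₀ (fromRows Q₁₀ τ₁) = I) (hL : minOpL H₀ (fromRows Q₁₀ τ₁) = L) (hS : effForm H₀ (fromRows Q₁₀ τ₁) = S)
    (hB : fromRows Q₁₁ (0 : Matrix ρ₁ ν ℝ) = B)
    (h1 : (kkt H₀ (fromRows Q₁₀ τ₁)).det ≠ 0)
    (h2 : (kkt (S.toBlocks₁₁ + G₀) (fromRows Q₂₀ τ₂)).det ≠ 0) :
    secondVar (kkt 𝔎₀ (fromRows 𝔔₀ P)) (kkt 𝔎₁ (fromRows 𝔔₁ (0 : Matrix (ρ₂ ⊕ ρ₁) ν ℝ))) (kkt 𝔎₂ (fromRows 𝔔₂ (0 : Matrix (ρ₂ ⊕ ρ₁) ν ℝ)))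
      = secondVar (kkt H₀ (fromRows Q₁₀ τ₁)) (kkt H₁ B) (kkt H₂ (fromRows Q₁₂ (0 : Matrix ρ₁ ν ℝ)))
        + secondVar
            (kkt (S.toBlocks₁₁ + G₀) (fromRows Q₂₀ τ₂))
            (kkt (((L * H₁ - S * B) * I - L * Bᵀ * S).toBlocks₁₁ + G₁) (fromRows Q₂₁ (0 : Matrix ρ₂ μ ℝ)))
            (kkt ((((-((L * H₁ - S * B) * Γ + L * Bᵀ * L) * H₁ + L * H₂
                      - (((L * H₁ - S * B) * I - L * Bᵀ * S) * B + S * fromRows Q₁₂ (0 : Matrix ρ₁ ν ℝ))) * I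
                    + (L * H₁ - S * B) * (-((Γ * H₁ + I * B) * I - Γ * Bᵀ * S)))
                  - ((-((L * H₁ - S * B) * Γ + L * Bᵀ * L) * Bᵀ + L * (fromRows Q₁₂ (0 : Matrix ρ₁ ν ℝ))ᵀ) * S
                      + L * Bᵀ * ((L * H₁ - S * B) * I - L * Bᵀ * S))).toBlocks₁₁ + G₂)
              (fromRows Q₂₂ (0 : Matrix ρ₂ μ ℝ))) := by
  -- the order-0 covariance letter in `[D̄ | 0]` form
  have c0 : Q₁₀ * fromCols D₂ D₁ = fromCols Dbar (0 : Matrix μ ρ₁ ℝ) := by rw [mul_fromCols, h₂, h₁]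
  have c1' : Q₁₁ * fromCols D₂ D₁ + Q₁₀ * (0 : Matrix ν (ρ₂ ⊕ ρ₁) ℝ) = fromCols (0 : Matrix μ ρ₂ ℝ) (0 : Matrix μ ρ₁ ℝ) := by
    rw [c1, fromCols_zero]; simp only [Matrix.mul_zero, add_zero]
  have c2' : Q₁₂ * fromCols D₂ D₁ + (2 : ℝ) • (Q₁₁ * (0 : Matrix ν (ρ₂ ⊕ ρ₁) ℝ)) + Q₁₀ * (0 : Matrix ν (ρ₂ ⊕ ρ₁) ℝ)
      = fromCols (0 : Matrix μ ρ₂ ℝ) (0 : Matrix μ ρ₁ ℝ) := by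
    rw [c2, fromCols_zero]; simp only [Matrix.mul_zero, smul_zero, add_zero]
  have d1' : Q₂₁ * Dbar + Q₂₀ * (0 : Matrix μ ρ₂ ℝ) = 0 := by rw [d1, Matrix.mul_zero, add_zero]
  have d2' : Q₂₂ * Dbar + (2 : ℝ) • (Q₂₁ * (0 : Matrix μ ρ₂ ℝ)) + Q₂₀ * (0 : Matrix μ ρ₂ ℝ) = 0 := by
    simp only [Matrix.mul_zero, smul_zero, add_zero]; exact d2
  -- the composite `𝔔`-letters (leaf-02 `CompositeWardLetters`)
  have b0 := compWard_b0 Q₁₀ Q₂₀ (fromCols D₂ D₁) Dbar c0 d0 h𝔔₀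
  have b1 := compWard_b1 Q₁₀ Q₁₁ Q₂₀ Q₂₁ (fromCols D₂ D₁) 0 Dbar 0 c0 c1' d1' h𝔔₀ h𝔔₁
  have b2 := compWard_b2 Q₁₀ Q₁₁ Q₁₂ Q₂₀ Q₂₁ Q₂₂ (fromCols D₂ D₁) 0 0 Dbar 0 0 c0 c1' c2' d2' h𝔔₀ h𝔔₁ h𝔔₂
  -- the nested Faddeev–Popov jets vanish in the static frame
  have j1 : fromRows (τ₂ * Q₁₁) (0 : Matrix ρ₁ ν ℝ) * fromCols D₂ D₁ = 0 := fromRows_mul_eq_zero_of_jet τ₂ Q₁₁ _ c1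
  have j2 : fromRows (τ₂ * Q₁₂) (0 : Matrix ρ₁ ν ℝ) * fromCols D₂ D₁ = 0 := fromRows_mul_eq_zero_of_jet τ₂ Q₁₂ _ c2
  refine secondVar_oneShot_nestedStepLaw_jets_of_uni H₀ H₁ H₂ Q₁₀ Q₁₁ Q₁₂ Q₂₀ Q₂₁ Q₂₂ G₀ G₁ G₂ τ₁ τ₂ P (fromCols D₂ D₁) 0 0 Y₀ Y₁ Y₂ Y'₀ Y'₁ Y'₂
    h𝔎₀ h𝔎₁ h𝔎₂ h𝔔₀ h𝔔₁ h𝔔₂ ?_ ?_ ?_ ?_ ?_ ?_ b0 b1 b2 ?_ ?_ ?_ ?_ hΓ hI hL hS hB h1 h2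
  · exact a0
  · simp only [Matrix.mul_zero, add_zero]; exact a1
  · simp only [Matrix.mul_zero, smul_zero, add_zero]; exact a2
  · exact a0t
  · simp only [Matrix.mul_zero, add_zero]; exact a1t
  · simp only [Matrix.mul_zero, smul_zero, add_zero]; exact a2t
  · exact det_ne_zero_of_abs_det hcP hc'0
  · exact det_nestedSlice_mul_gauge_ne_zero τ₁ τ₂ Q₁₀ D₁ D₂ Dbar h₁ h₂ hc₁ hc₂ hc₁0 hc₂0
  · rw [Matrix.mul_zero]; exact secondVar_zero_jets _
  · rw [j1, j2]
    simp only [Matrix.mul_zero, add_zero]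
    exact secondVar_zero_jets _

end Static

/-! ## §3 THE CALL in letter form — FOREST frame (moving generators, Faddeev–Popov 2-jets triangular along one ranked forest) -/

section Forest

variable {ν μ κ ρ₁ ρ₂ σ : Type*} [Fintype ν] [Fintype μ] [Fintype κ] [Fintype ρ₁] [Fintype ρ₂] [Fintype σ]
  [DecidableEq ν] [DecidableEq μ] [DecidableEq κ] [DecidableEq ρ₁] [DecidableEq ρ₂] [DecidableEq σ]

/-- [folklore] **THE ONE-SHOT-SLICED COMPOSITE STEP LAW FROM THE LETTER CHECKLIST, FOREST FRAME.**  Data and composite Ward letters as in p308750 (moving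
generators `W₀ W₁ W₂`, coarse generator jets `D̄₀ D̄₁ D̄₂`); one-step covariance jets `c0 c1 c2` and coarse Ward jets `d0 d1 d2` (leaf-02's shapes); (UNI) at jet
level REPLACED by: the two Faddeev–Popov 2-jets — `(P·W₀, P·W₁, P·W₂)` and the nested `([τ₂Q₁₀;τ₁]·W₀, …, …)` NAMED `T₀' T₁' T₂'` — are triangular along ONE ranked
forest `(site, rk, parent)` on the parameter index `ρ₂ ⊕ ρ₁`, with non-degenerate site blocks of vanishing `secondVar` (colour-stripped: scalar blocks with
`d₀d₂ = d₁²`, `ForestTriangularJets.secondVar_unique_eq_zero`); (UNI) order 0 (`hPW`, `hTW`) FOLLOWS (`det = ∏` site blocks, leaf-06 `det_of_forestTriangular`).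
Conclusion: p308750's, with ZERO Faddeev–Popov defect. -/
theorem secondVar_oneShot_nestedStepLaw_of_letters_forest
    (H₀ H₁ H₂ : Matrix ν ν ℝ) (Q₁₀ Q₁₁ Q₁₂ : Matrix μ ν ℝ) (Q₂₀ Q₂₁ Q₂₂ : Matrix κ μ ℝ) (G₀ G₁ G₂ : Matrix μ μ ℝ)
    (τ₁ : Matrix ρ₁ ν ℝ) (τ₂ : Matrix ρ₂ μ ℝ) (P : Matrix (ρ₂ ⊕ ρ₁) ν ℝ) (W₀ W₁ W₂ : Matrix ν (ρ₂ ⊕ ρ₁) ℝ) (Db₀ Db₁ Db₂ : Matrix μ ρ₂ ℝ)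
    (Y₀ Y₁ Y₂ Y'₀ Y'₁ Y'₂ : Matrix κ (ρ₂ ⊕ ρ₁) ℝ)
    {𝔎₀ 𝔎₁ 𝔎₂ : Matrix ν ν ℝ} {𝔔₀ 𝔔₁ 𝔔₂ : Matrix κ ν ℝ}
    (h𝔎₀ : H₀ + Q₁₀ᵀ * G₀ * Q₁₀ = 𝔎₀) (h𝔎₁ : H₁ + (Q₁₁ᵀ * G₀ * Q₁₀ + Q₁₀ᵀ * G₁ * Q₁₀ + Q₁₀ᵀ * G₀ * Q₁₁) = 𝔎₁)
    (h𝔎₂ : H₂ + ((Q₁₂ᵀ * G₀ * Q₁₀ + Q₁₁ᵀ * G₁ * Q₁₀ + Q₁₁ᵀ * G₀ * Q₁₁) + (Q₁₁ᵀ * G₁ * Q₁₀ + Q₁₀ᵀ * G₂ * Q₁₀ + Q₁₀ᵀ * G₁ * Q₁₁)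
            + (Q₁₁ᵀ * G₀ * Q₁₁ + Q₁₀ᵀ * G₁ * Q₁₁ + Q₁₀ᵀ * G₀ * Q₁₂)) = 𝔎₂)
    (h𝔔₀ : Q₂₀ * Q₁₀ = 𝔔₀) (h𝔔₁ : Q₂₁ * Q₁₀ + Q₂₀ * Q₁₁ = 𝔔₁) (h𝔔₂ : Q₂₂ * Q₁₀ + Q₂₁ * Q₁₁ + (Q₂₁ * Q₁₁ + Q₂₀ * Q₁₂) = 𝔔₂)
    (a0 : 𝔎₀ * W₀ = 𝔔₀ᵀ * Y₀) (a1 : 𝔎₁ * W₀ + 𝔎₀ * W₁ = 𝔔₁ᵀ * Y₀ + 𝔔₀ᵀ * Y₁)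
    (a2 : 𝔎₂ * W₀ + (2 : ℝ) • (𝔎₁ * W₁) + 𝔎₀ * W₂ = 𝔔₂ᵀ * Y₀ + (2 : ℝ) • (𝔔₁ᵀ * Y₁) + 𝔔₀ᵀ * Y₂)
    (a0t : 𝔎₀ᵀ * W₀ = 𝔔₀ᵀ * Y'₀) (a1t : 𝔎₁ᵀ * W₀ + 𝔎₀ᵀ * W₁ = 𝔔₁ᵀ * Y'₀ + 𝔔₀ᵀ * Y'₁)
    (a2t : 𝔎₂ᵀ * W₀ + (2 : ℝ) • (𝔎₁ᵀ * W₁) + 𝔎₀ᵀ * W₂ = 𝔔₂ᵀ * Y'₀ + (2 : ℝ) • (𝔔₁ᵀ * Y'₁) + 𝔔₀ᵀ * Y'₂)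
    -- one-step covariance jets and coarse Ward jets (leaf-02 `CompositeWardLetters` shapes)
    (c0 : Q₁₀ * W₀ = fromCols Db₀ 0) (c1 : Q₁₁ * W₀ + Q₁₀ * W₁ = fromCols Db₁ 0)
    (c2 : Q₁₂ * W₀ + (2 : ℝ) • (Q₁₁ * W₁) + Q₁₀ * W₂ = fromCols Db₂ 0)
    (d0 : Q₂₀ * Db₀ = 0) (d1 : Q₂₁ * Db₀ + Q₂₀ * Db₁ = 0) (d2 : Q₂₂ * Db₀ + (2 : ℝ) • (Q₂₁ * Db₁) + Q₂₀ * Db₂ = 0)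
    -- the nested Faddeev–Popov 2-jet, NAMED
    {T₀' T₁' T₂' : Matrix (ρ₂ ⊕ ρ₁) (ρ₂ ⊕ ρ₁) ℝ}
    (hT₀ : fromRows (τ₂ * Q₁₀) τ₁ * W₀ = T₀') (hT₁ : fromRows (τ₂ * Q₁₁) (0 : Matrix ρ₁ ν ℝ) * W₀ + fromRows (τ₂ * Q₁₀) τ₁ * W₁ = T₁')
    (hT₂ : fromRows (τ₂ * Q₁₂) (0 : Matrix ρ₁ ν ℝ) * W₀ + fromRows (τ₂ * Q₁₁) (0 : Matrix ρ₁ ν ℝ) * W₁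
        + (fromRows (τ₂ * Q₁₁) (0 : Matrix ρ₁ ν ℝ) * W₁ + fromRows (τ₂ * Q₁₀) τ₁ * W₂) = T₂')
    -- ONE ranked forest on the parameter index; both Faddeev–Popov 2-jets triangular along it; site blocks non-degenerate with `secondVar = 0`
    (site : ρ₂ ⊕ ρ₁ → σ) (rk : σ → ℕ) (parent : σ → Option σ) (hrk : ∀ x p, parent x = some p → rk p < rk x)
    (p₀ : ∀ i j, (P * W₀) i j ≠ 0 → site j = site i ∨ parent (site i) = some (site j))
    (p₁ : ∀ i j, (P * W₁) i j ≠ 0 → site j = site i ∨ parent (site i) = some (site j))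
    (p₂ : ∀ i j, (P * W₂) i j ≠ 0 → site j = site i ∨ parent (site i) = some (site j))
    (pdet : ∀ x ∈ univ.image site, ((P * W₀).toSquareBlock site x).det ≠ 0)
    (pzero : ∀ x ∈ univ.image site, secondVar ((P * W₀).toSquareBlock site x) ((P * W₁).toSquareBlock site x) ((P * W₂).toSquareBlock site x) = 0)
    (t₀ : ∀ i j, T₀' i j ≠ 0 → site j = site i ∨ parent (site i) = some (site j))
    (t₁ : ∀ i j, T₁' i j ≠ 0 → site j = site i ∨ parent (site i) = some (site j))
    (t₂ : ∀ i j, T₂' i j ≠ 0 → site j = site i ∨ parent (site i) = some (site j))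
    (tdet : ∀ x ∈ univ.image site, (T₀'.toSquareBlock site x).det ≠ 0)
    (tzero : ∀ x ∈ univ.image site, secondVar (T₀'.toSquareBlock site x) (T₁'.toSquareBlock site x) (T₂'.toSquareBlock site x) = 0)
    {Γ : Matrix ν ν ℝ} {I : Matrix ν (μ ⊕ ρ₁) ℝ} {L : Matrix (μ ⊕ ρ₁) ν ℝ} {S : Matrix (μ ⊕ ρ₁) (μ ⊕ ρ₁) ℝ} {B : Matrix (μ ⊕ ρ₁) ν ℝ}
    (hΓ : flucCov H₀ (fromRows Q₁₀ τ₁) = Γ) (hI : minOp H₀ (fromRows Q₁₀ τ₁) = I) (hL : minOpL H₀ (fromRows Q₁₀ τ₁) = L) (hS : effForm H₀ (fromRows Q₁₀ τ₁) = S)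
    (hB : fromRows Q₁₁ (0 : Matrix ρ₁ ν ℝ) = B)
    (h1 : (kkt H₀ (fromRows Q₁₀ τ₁)).det ≠ 0)
    (h2 : (kkt (S.toBlocks₁₁ + G₀) (fromRows Q₂₀ τ₂)).det ≠ 0) :
    secondVar (kkt 𝔎₀ (fromRows 𝔔₀ P)) (kkt 𝔎₁ (fromRows 𝔔₁ (0 : Matrix (ρ₂ ⊕ ρ₁) ν ℝ))) (kkt 𝔎₂ (fromRows 𝔔₂ (0 : Matrix (ρ₂ ⊕ ρ₁) ν ℝ)))
      = secondVar (kkt H₀ (fromRows Q₁₀ τ₁)) (kkt H₁ B) (kkt H₂ (fromRows Q₁₂ (0 : Matrix ρ₁ ν ℝ)))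
        + secondVar
            (kkt (S.toBlocks₁₁ + G₀) (fromRows Q₂₀ τ₂))
            (kkt (((L * H₁ - S * B) * I - L * Bᵀ * S).toBlocks₁₁ + G₁) (fromRows Q₂₁ (0 : Matrix ρ₂ μ ℝ)))
            (kkt ((((-((L * H₁ - S * B) * Γ + L * Bᵀ * L) * H₁ + L * H₂
                      - (((L * H₁ - S * B) * I - L * Bᵀ * S) * B + S * fromRows Q₁₂ (0 : Matrix ρ₁ ν ℝ))) * I
                    + (L * H₁ - S * B) * (-((Γ * H₁ + I * B) * I - Γ * Bᵀ * S)))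
                  - ((-((L * H₁ - S * B) * Γ + L * Bᵀ * L) * Bᵀ + L * (fromRows Q₁₂ (0 : Matrix ρ₁ ν ℝ))ᵀ) * S
                      + L * Bᵀ * ((L * H₁ - S * B) * I - L * Bᵀ * S))).toBlocks₁₁ + G₂)
              (fromRows Q₂₂ (0 : Matrix ρ₂ μ ℝ))) := by
  have b0 := compWard_b0 Q₁₀ Q₂₀ W₀ Db₀ c0 d0 h𝔔₀
  have b1 := compWard_b1 Q₁₀ Q₁₁ Q₂₀ Q₂₁ W₀ W₁ Db₀ Db₁ c0 c1 d1 h𝔔₀ h𝔔₁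
  have b2 := compWard_b2 Q₁₀ Q₁₁ Q₁₂ Q₂₀ Q₂₁ Q₂₂ W₀ W₁ W₂ Db₀ Db₁ Db₂ c0 c1 c2 d2 h𝔔₀ h𝔔₁ h𝔔₂
  -- (UNI) order 0 from the forest: `det = ∏ (site blocks)` (leaf-06 `det_of_forestTriangular`)
  have hPW : (P * W₀).det ≠ 0 := by
    rw [det_of_forestTriangular (P * W₀) site rk parent hrk p₀]; exact Finset.prod_ne_zero_iff.mpr pdet
  have hTW : (fromRows (τ₂ * Q₁₀) τ₁ * W₀).det ≠ 0 := by
    rw [hT₀, det_of_forestTriangular T₀' site rk parent hrk t₀]; exact Finset.prod_ne_zero_iff.mpr tdet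
  have hUP : secondVar (P * W₀) (P * W₁) (P * W₂) = 0 :=
    secondVar_forestTriangular_jets_eq_zero _ _ _ site rk parent hrk p₀ p₁ p₂ pdet pzero
  have hUT : secondVar T₀' T₁' T₂' = 0 := secondVar_forestTriangular_jets_eq_zero _ _ _ site rk parent hrk t₀ t₁ t₂ tdet tzero
  rw [← hT₀, ← hT₁, ← hT₂] at hUT
  exact secondVar_oneShot_nestedStepLaw_jets_of_uni H₀ H₁ H₂ Q₁₀ Q₁₁ Q₁₂ Q₂₀ Q₂₁ Q₂₂ G₀ G₁ G₂ τ₁ τ₂ P W₀ W₁ W₂ Y₀ Y₁ Y₂ Y'₀ Y'₁ Y'₂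
    h𝔎₀ h𝔎₁ h𝔎₂ h𝔔₀ h𝔔₁ h𝔔₂ a0 a1 a2 a0t a1t a2t b0 b1 b2 hPW hTW hUP hUT hΓ hI hL hS hB h1 h2

end Forest

/-! ## §4 Static basis change of the generators (sub-row (iii-b) «big-comb basis change», generic half) -/

section BasisChange

variable {ι : Type*} [Fintype ι] [DecidableEq ι]

/-- [folklore] **`secondVar` IS INVARIANT UNDER A STATIC INVERTIBLE RIGHT FACTOR**: `secondVar (A₀C) (A₁C) (A₂C) = secondVar A₀ A₁ A₂` (`log|det(A(u)·C)| =
log|det A(u)| + const`).  Use: the one-shot slice's generator matrix `W₀ = [D₂|D₁]` is the big comb's gradient-reading basis times a static unipotent `C`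
(TID-LETTER-SPEC v1.2 (iii-b)); the (UNI) letters are checked in either basis. -/
theorem secondVar_mul_right (A₀ A₁ A₂ C : Matrix ι ι ℝ) (hC : IsUnit C.det) :
    secondVar (A₀ * C) (A₁ * C) (A₂ * C) = secondVar A₀ A₁ A₂ := by
  have hCC : C * C⁻¹ = 1 := Matrix.mul_nonsing_inv C hC
  have e2 : (A₀ * C)⁻¹ * (A₂ * C) = C⁻¹ * (A₀⁻¹ * A₂) * C := by
    rw [Matrix.mul_inv_rev]; simp only [Matrix.mul_assoc]
  have e1 : (A₀ * C)⁻¹ * (A₁ * C) = C⁻¹ * (A₀⁻¹ * A₁) * C := by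
    rw [Matrix.mul_inv_rev]; simp only [Matrix.mul_assoc]
  have sq : C⁻¹ * (A₀⁻¹ * A₁) * C * (C⁻¹ * (A₀⁻¹ * A₁) * C) = C⁻¹ * (A₀⁻¹ * A₁ * (A₀⁻¹ * A₁)) * C := by
    calc C⁻¹ * (A₀⁻¹ * A₁) * C * (C⁻¹ * (A₀⁻¹ * A₁) * C)
        = C⁻¹ * (A₀⁻¹ * A₁) * (C * C⁻¹) * (A₀⁻¹ * A₁) * C := by simp only [Matrix.mul_assoc]
      _ = C⁻¹ * (A₀⁻¹ * A₁ * (A₀⁻¹ * A₁)) * C := by rw [hCC, Matrix.mul_one]; simp only [Matrix.mul_assoc]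
  have cyc : ∀ X : Matrix ι ι ℝ, (C⁻¹ * X * C).trace = X.trace := fun X => by
    rw [Matrix.trace_mul_cycle, hCC, Matrix.one_mul]
  unfold secondVar
  rw [e2, e1, sq, cyc, cyc]

/-- [folklore] and the order-0 binder transports: `det(A·C) ≠ 0 ↔ det A ≠ 0` for `det C ≠ 0`. -/
theorem det_mul_ne_zero_iff (A C : Matrix ι ι ℝ) (hC : C.det ≠ 0) : (A * C).det ≠ 0 ↔ A.det ≠ 0 := by
  rw [Matrix.det_mul, mul_ne_zero_iff, and_iff_left hC]

end BasisChange

/-! ## §5 THE CALL in letter form — HAAR frame (exit (E3) of Q-FP-17-2′: the one-shot slice reads only dead bonds, the nested Faddeev–Popov 2-jet is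
forest-triangular, and its per-site defect is DISPLAYED as a finite sum) -/

section Haar

variable {ν μ κ ρ₁ ρ₂ σ : Type*} [Fintype ν] [Fintype μ] [Fintype κ] [Fintype ρ₁] [Fintype ρ₂] [Fintype σ]
  [DecidableEq ν] [DecidableEq μ] [DecidableEq κ] [DecidableEq ρ₁] [DecidableEq ρ₂] [DecidableEq σ]

/-- [folklore] **THE ONE-SHOT-SLICED COMPOSITE STEP LAW FROM THE LETTER CHECKLIST WITH THE NESTED FADDEEV–POPOV DEFECT DISPLAYED AS A PER-SITE SUM.**
Data and letters as in `…_of_letters_forest`, except: on the ONE-SHOT side only `P·W₁ = 0`, `P·W₂ = 0` (ultralocality: the slice rows read dead bonds, where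
neither the background nor the insertion lives — Q-FP-17-2′ (O1)(O2)) and `det(P·W₀) ≠ 0`; on the NESTED side the 2-jet `T₀' T₁' T₂'` is triangular along a
ranked forest with non-degenerate site blocks but NO per-site `secondVar = 0` letter.  Conclusion: p308750's fine + coarse terms MINUS
`2·Σ_x secondVar(site block of T')` — along one-shot insertions that are nested-dead this is the Haar-type term `(1∕6)·Σ (ad E)²` of Q-FP-17-2′ (O3);
when every site block has `secondVar = 0` it is `…_of_letters_forest`. -/
theorem secondVar_oneShot_nestedStepLaw_of_letters_haar
    (H₀ H₁ H₂ : Matrix ν ν ℝ) (Q₁₀ Q₁₁ Q₁₂ : Matrix μ ν ℝ) (Q₂₀ Q₂₁ Q₂₂ : Matrix κ μ ℝ) (G₀ G₁ G₂ : Matrix μ μ ℝ)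
    (τ₁ : Matrix ρ₁ ν ℝ) (τ₂ : Matrix ρ₂ μ ℝ) (P : Matrix (ρ₂ ⊕ ρ₁) ν ℝ) (W₀ W₁ W₂ : Matrix ν (ρ₂ ⊕ ρ₁) ℝ) (Db₀ Db₁ Db₂ : Matrix μ ρ₂ ℝ)
    (Y₀ Y₁ Y₂ Y'₀ Y'₁ Y'₂ : Matrix κ (ρ₂ ⊕ ρ₁) ℝ)
    {𝔎₀ 𝔎₁ 𝔎₂ : Matrix ν ν ℝ} {𝔔₀ 𝔔₁ 𝔔₂ : Matrix κ ν ℝ}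
    (h𝔎₀ : H₀ + Q₁₀ᵀ * G₀ * Q₁₀ = 𝔎₀) (h𝔎₁ : H₁ + (Q₁₁ᵀ * G₀ * Q₁₀ + Q₁₀ᵀ * G₁ * Q₁₀ + Q₁₀ᵀ * G₀ * Q₁₁) = 𝔎₁)
    (h𝔎₂ : H₂ + ((Q₁₂ᵀ * G₀ * Q₁₀ + Q₁₁ᵀ * G₁ * Q₁₀ + Q₁₁ᵀ * G₀ * Q₁₁) + (Q₁₁ᵀ * G₁ * Q₁₀ + Q₁₀ᵀ * G₂ * Q₁₀ + Q₁₀ᵀ * G₁ * Q₁₁)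
            + (Q₁₁ᵀ * G₀ * Q₁₁ + Q₁₀ᵀ * G₁ * Q₁₁ + Q₁₀ᵀ * G₀ * Q₁₂)) = 𝔎₂)
    (h𝔔₀ : Q₂₀ * Q₁₀ = 𝔔₀) (h𝔔₁ : Q₂₁ * Q₁₀ + Q₂₀ * Q₁₁ = 𝔔₁) (h𝔔₂ : Q₂₂ * Q₁₀ + Q₂₁ * Q₁₁ + (Q₂₁ * Q₁₁ + Q₂₀ * Q₁₂) = 𝔔₂)
    (a0 : 𝔎₀ * W₀ = 𝔔₀ᵀ * Y₀) (a1 : 𝔎₁ * W₀ + 𝔎₀ * W₁ = 𝔔₁ᵀ * Y₀ + 𝔔₀ᵀ * Y₁)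
    (a2 : 𝔎₂ * W₀ + (2 : ℝ) • (𝔎₁ * W₁) + 𝔎₀ * W₂ = 𝔔₂ᵀ * Y₀ + (2 : ℝ) • (𝔔₁ᵀ * Y₁) + 𝔔₀ᵀ * Y₂)
    (a0t : 𝔎₀ᵀ * W₀ = 𝔔₀ᵀ * Y'₀) (a1t : 𝔎₁ᵀ * W₀ + 𝔎₀ᵀ * W₁ = 𝔔₁ᵀ * Y'₀ + 𝔔₀ᵀ * Y'₁)
    (a2t : 𝔎₂ᵀ * W₀ + (2 : ℝ) • (𝔎₁ᵀ * W₁) + 𝔎₀ᵀ * W₂ = 𝔔₂ᵀ * Y'₀ + (2 : ℝ) • (𝔔₁ᵀ * Y'₁) + 𝔔₀ᵀ * Y'₂)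
    (c0 : Q₁₀ * W₀ = fromCols Db₀ 0) (c1 : Q₁₁ * W₀ + Q₁₀ * W₁ = fromCols Db₁ 0)
    (c2 : Q₁₂ * W₀ + (2 : ℝ) • (Q₁₁ * W₁) + Q₁₀ * W₂ = fromCols Db₂ 0)
    (d0 : Q₂₀ * Db₀ = 0) (d1 : Q₂₁ * Db₀ + Q₂₀ * Db₁ = 0) (d2 : Q₂₂ * Db₀ + (2 : ℝ) • (Q₂₁ * Db₁) + Q₂₀ * Db₂ = 0)
    -- one-shot side: the slice rows read dead bonds (Q-FP-17-2′ (O2))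
    (hP₁ : P * W₁ = 0) (hP₂ : P * W₂ = 0) (hPW : (P * W₀).det ≠ 0)
    -- nested side: the Faddeev–Popov 2-jet NAMED and triangular along one ranked forest, site blocks non-degenerate
    {T₀' T₁' T₂' : Matrix (ρ₂ ⊕ ρ₁) (ρ₂ ⊕ ρ₁) ℝ}
    (hT₀ : fromRows (τ₂ * Q₁₀) τ₁ * W₀ = T₀') (hT₁ : fromRows (τ₂ * Q₁₁) (0 : Matrix ρ₁ ν ℝ) * W₀ + fromRows (τ₂ * Q₁₀) τ₁ * W₁ = T₁')
    (hT₂ : fromRows (τ₂ * Q₁₂) (0 : Matrix ρ₁ ν ℝ) * W₀ + fromRows (τ₂ * Q₁₁) (0 : Matrix ρ₁ ν ℝ) * W₁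
        + (fromRows (τ₂ * Q₁₁) (0 : Matrix ρ₁ ν ℝ) * W₁ + fromRows (τ₂ * Q₁₀) τ₁ * W₂) = T₂')
    (site : ρ₂ ⊕ ρ₁ → σ) (rk : σ → ℕ) (parent : σ → Option σ) (hrk : ∀ x p, parent x = some p → rk p < rk x)
    (t₀ : ∀ i j, T₀' i j ≠ 0 → site j = site i ∨ parent (site i) = some (site j))
    (t₁ : ∀ i j, T₁' i j ≠ 0 → site j = site i ∨ parent (site i) = some (site j))
    (t₂ : ∀ i j, T₂' i j ≠ 0 → site j = site i ∨ parent (site i) = some (site j))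
    (tdet : ∀ x ∈ univ.image site, (T₀'.toSquareBlock site x).det ≠ 0)
    {Γ : Matrix ν ν ℝ} {I : Matrix ν (μ ⊕ ρ₁) ℝ} {L : Matrix (μ ⊕ ρ₁) ν ℝ} {S : Matrix (μ ⊕ ρ₁) (μ ⊕ ρ₁) ℝ} {B : Matrix (μ ⊕ ρ₁) ν ℝ}
    (hΓ : flucCov H₀ (fromRows Q₁₀ τ₁) = Γ) (hI : minOp H₀ (fromRows Q₁₀ τ₁) = I) (hL : minOpL H₀ (fromRows Q₁₀ τ₁) = L) (hS : effForm H₀ (fromRows Q₁₀ τ₁) = S)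
    (hB : fromRows Q₁₁ (0 : Matrix ρ₁ ν ℝ) = B)
    (h1 : (kkt H₀ (fromRows Q₁₀ τ₁)).det ≠ 0)
    (h2 : (kkt (S.toBlocks₁₁ + G₀) (fromRows Q₂₀ τ₂)).det ≠ 0) :
    secondVar (kkt 𝔎₀ (fromRows 𝔔₀ P)) (kkt 𝔎₁ (fromRows 𝔔₁ (0 : Matrix (ρ₂ ⊕ ρ₁) ν ℝ))) (kkt 𝔎₂ (fromRows 𝔔₂ (0 : Matrix (ρ₂ ⊕ ρ₁) ν ℝ)))
      = secondVar (kkt H₀ (fromRows Q₁₀ τ₁)) (kkt H₁ B) (kkt H₂ (fromRows Q₁₂ (0 : Matrix ρ₁ ν ℝ)))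
        + secondVar
            (kkt (S.toBlocks₁₁ + G₀) (fromRows Q₂₀ τ₂))
            (kkt (((L * H₁ - S * B) * I - L * Bᵀ * S).toBlocks₁₁ + G₁) (fromRows Q₂₁ (0 : Matrix ρ₂ μ ℝ)))
            (kkt ((((-((L * H₁ - S * B) * Γ + L * Bᵀ * L) * H₁ + L * H₂
                      - (((L * H₁ - S * B) * I - L * Bᵀ * S) * B + S * fromRows Q₁₂ (0 : Matrix ρ₁ ν ℝ))) * I
                    + (L * H₁ - S * B) * (-((Γ * H₁ + I * B) * I - Γ * Bᵀ * S)))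
                  - ((-((L * H₁ - S * B) * Γ + L * Bᵀ * L) * Bᵀ + L * (fromRows Q₁₂ (0 : Matrix ρ₁ ν ℝ))ᵀ) * S
                      + L * Bᵀ * ((L * H₁ - S * B) * I - L * Bᵀ * S))).toBlocks₁₁ + G₂)
              (fromRows Q₂₂ (0 : Matrix ρ₂ μ ℝ)))
        - 2 * ∑ x ∈ univ.image site, secondVar (T₀'.toSquareBlock site x) (T₁'.toSquareBlock site x) (T₂'.toSquareBlock site x) := by
  have b0 := compWard_b0 Q₁₀ Q₂₀ W₀ Db₀ c0 d0 h𝔔₀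
  have b1 := compWard_b1 Q₁₀ Q₁₁ Q₂₀ Q₂₁ W₀ W₁ Db₀ Db₁ c0 c1 d1 h𝔔₀ h𝔔₁
  have b2 := compWard_b2 Q₁₀ Q₁₁ Q₁₂ Q₂₀ Q₂₁ Q₂₂ W₀ W₁ W₂ Db₀ Db₁ Db₂ c0 c1 c2 d2 h𝔔₀ h𝔔₁ h𝔔₂
  have hTW : (fromRows (τ₂ * Q₁₀) τ₁ * W₀).det ≠ 0 := by
    rw [hT₀, det_of_forestTriangular T₀' site rk parent hrk t₀]; exact Finset.prod_ne_zero_iff.mpr tdet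
  have hUP : secondVar (P * W₀) (P * W₁) (P * W₂) = 0 := by rw [hP₁, hP₂]; exact secondVar_zero_jets _
  have hT : secondVar T₀' T₁' T₂' = ∑ x ∈ univ.image site, secondVar (T₀'.toSquareBlock site x) (T₁'.toSquareBlock site x) (T₂'.toSquareBlock site x) :=
    secondVar_forestTriangular_jets _ _ _ site rk parent hrk t₀ t₁ t₂ tdet
  rw [secondVar_oneShot_nestedStepLaw_jets H₀ H₁ H₂ Q₁₀ Q₁₁ Q₁₂ Q₂₀ Q₂₁ Q₂₂ G₀ G₁ G₂ τ₁ τ₂ P W₀ W₁ W₂ Y₀ Y₁ Y₂ Y'₀ Y'₁ Y'₂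
    h𝔎₀ h𝔎₁ h𝔎₂ h𝔔₀ h𝔔₁ h𝔔₂ a0 a1 a2 a0t a1t a2t b0 b1 b2 hPW hTW hΓ hI hL hS hB h1 h2, hUP, hT₀, hT₁, hT₂, hT]
  ring

end Haar

end Summit.QuantumFields.BalabanUV.Beta.FP.NestedStepLawOneShotLetters
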